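import Mathlib
import Summits.ValiantsHypothesis.ValiantsHypothesis.Theorems.NewtonUnitEquationsTwoProductsFormalLogLinearisationDefs
import Summits.ValiantsHypothesis.ValiantsHypothesis.Theorems.TwoProducts.Negative.RowCoincidenceThreeDigitBox
import Summits.ValiantsHypothesis.ValiantsHypothesis.Theorems.TwoProducts.Negative.RowRigiditySquareDifference
import HarnessLib

/-!
# A third exception to box row-rigidity: the Vandermonde-defect witness (affine rank 3), and D2 is false at `m = 3`

Negative lane, `--supports stmt-ValiantsHypothesis-5906` (route `NewtonUnitEquations`, crux `TwoProducts`, line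
`relation_ladder` / idea `subbox-congruence-cascade` / first-variation lens).  Theorems PORT (val-port-4, 2026-08-29) of §1–§2 of
the ideator file `Cruxes/TwoProducts/FirstVariation_val_idea_34_g11.lean` (val-idea-34 g11, b6c6839d0ab40b5e; critic
val-idea-crit-8 g3 VERDICT #30 (C) «VD witness ★», director-valiant R349 (1)).  No summit statement is proved here.
**VP ≠ VNP is NOT proved; `TwoProducts` (5906), `ResidualLawV25`, `PlanarCellBound`, `DigitGridLLLaw` stay OPEN.**

CURRENCY.  Everything is stated over the LANDED definitions `boxTrunc` / `DigitGrid` / `llVisible` (and the letters `et = (4,4)`,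
`pp = 2·et = (8,8)`, the weight `xi = (−1,−1)`) of `…Negative.RowCoincidenceThreeDigitBox` and the three-letter rows
`row3 a b c = a·X^{zz} + b·X^{z2} + c·X^{et}` (`zz = (1,1)`, `z2 = (2,2)`) of `…Negative.RowRigiditySquareDifference`; nothing
is re-declared.  Port dictionary (source ↦ here): `la ↦ zz`, `le ↦ z2`, `lt ↦ et`, `pp ↦ pp`, `row ↦ row3`, tails `uu/vv ↦ du/dv`;
the theorem STATEMENTS are otherwise verbatim.  §3 of the source (typed OPEN targets `llVisibleOf`, `firstVariation`,
`LinearisedLLLaw(Linear)`, `DigitGridLLLaw'`, `FirstVariationTransfer` — conjectural Props, nothing asserted) is NOT ported: it is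
not Negative-lane content and stays in the Cruxes workfile.

THE MOVE (val-idea-34 g11).  Restrict the two-products difference to pairs whose DIFFERENCE DATUM HAS RANK ONE,
`v_j = u_j + τ_j·X^t`.  Then `∏(1+v_j) − ∏(1+u_j) = X^t·G_τ + X^{2t}·G₂ + … + X^{mt}·τ₁⋯τ_m` with the FIRST VARIATION
`G_τ = Σ_j τ_j ∏_{i≠j}(1+u_i) = (∏_i (1+u_i)) · Σ_j τ_j/(1+u_j)`.

§1 VANDERMONDE-DEFECT WITNESS (`s = 3`, `m = 3`, base 2, integer coefficients; exact).  Rows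
`1 + u = (1 + 2X^a, 1 − 2X^a, 1 − 4X^e)`, `1 + v = (1 + 2X^a + X^t, 1 − 2X^a + X^t, 1 − 4X^e − 2X^t)` with the DIAGONAL letters
`a = zz = (1,1)`, `e = z2 = (2,2) = 2a`, `t = et = (4,4) = 2e`: the carry `(1+2X^a)(1−2X^a) = 1 − 4X^e` makes `Σ_j τ_j/(1+u_j) = 0`
for `τ = (1,1,−2)` although no two rows are proportional (the partial-fraction / Vandermonde uniqueness of the carry-free world
fails in base 2), hence `G_τ = 0` EXACTLY and `∏(1+u) − ∏(1+v) = 3X^{(8,8)} + 4X^{(10,10)} + 2X^{(12,12)}` (`tailDiff_eq`).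
So `p = (2³,2³)` is LL-visible (`pp_mem_llVisible`), its identity box `[0,2³)²` contains EVERY letter of every row, the truncated
rows are the rows themselves, they are NOT equal as multisets (`truncated_rows_ne`; not projectively either), and the truncated
table `{u_j^B} ∪ {v_j^B}` has AFFINE RANK 3 (`not_affRankLeTwo`: the differences `−4X^a`, `−2X^a − 4X^e`, `X^t` are linearly
independent).

§2 CONSEQUENCE (`not_coincidence_or_affRankLeTwo`).  The RIGIDITY-OR-RANK-TWO dichotomy D2 proposed on the bus
(val-idea-crit-8 g3, val-lit STATUS 2026-08-29T02:52:24Z: «∀ γ1 instance, ∀ LL-visible p of class ≥ (3,3): rows on B(p)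
coincide as a projective multiset OR the B(p)-truncated table has affine rank ≤ 2») is FALSE at `m = 3` as worded — typed with
the quantifier shape of `not_rowCoincidence_on_digitGrid` and the weakest reading of «affine rank ≤ 2» (all `2m` truncated rows in
one affine 2-plane `w₀ + span{w₁,w₂}`; the projective/linear reading implies it).  Companions in this directory: the top-letter
pencil family `E_T` (`…RowCoincidence.threeDigitBox_witness`) and the square-difference witness
(`…SquareDifference.squareDifference_witness`); this is a THIRD mechanism (affine rank 3, not a pencil, not `E_T`).

HONEST FRAME: a negative lemma on a proposed junction statement; `TwoProducts`, `ResidualLawV25`, `PlanarCellBound`,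
`DigitGridLLLaw(Linear)`, (U1″) and `VP ≠ VNP` are UNTOUCHED / NOT proved. [folklore]
-/

noncomputable section

set_option linter.dupNamespace false

open scoped BigOperators
open MvPolynomial
open Summit.ValiantsHypothesis.ValiantsHypothesis.Theorems.NewtonUnitEquations.TwoProducts.FormalLogLinearisation
open Summit.ValiantsHypothesis.ValiantsHypothesis.Theorems.NewtonUnitEquations.TwoProducts.Negative.RowCoincidence
  (boxTrunc DigitGrid llVisible coeff_boxTrunc C_mul_X_eq et et_zero et_one pp pp_zero pp_one xi xi_zero xi_one wt_xi)
open Summit.ValiantsHypothesis.ValiantsHypothesis.Theorems.NewtonUnitEquations.TwoProducts.Negative.SquareDifference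
  (zz z2 zz_ne_z2 zz_ne_et z2_ne_et row3 coeff_row3 coeff_row3_zz coeff_row3_z2 coeff_row3_et row3_eq mem_support_row3
    wt_row3_neg boxTrunc_row3)

namespace Summit.ValiantsHypothesis.ValiantsHypothesis.Theorems.NewtonUnitEquations.TwoProducts.Negative.VandermondeDefect

/-! ## §1  The Vandermonde-defect witness (`s = 3`, `m = 3`) -/

/-- `a₀ = 1` for the letter `a = zz = (1,1)`. -/
@[simp] theorem zz_zero : zz 0 = 1 := by simp [zz]
/-- `a₁ = 1`. -/
@[simp] theorem zz_one : zz 1 = 1 := by simp [zz]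
/-- `e₀ = 2` for the letter `e = z2 = (2,2)`. -/
@[simp] theorem z2_zero : z2 0 = 2 := by simp [z2]
/-- `e₁ = 2`. -/
@[simp] theorem z2_one : z2 1 = 2 := by simp [z2]

/-- `2t ≠ 2t + e`. -/
theorem pp_ne_ppz2 : pp ≠ pp + z2 := fun h => by have := congrArg (· 0) h; simp at this
/-- `2t ≠ 3t`. -/
theorem pp_ne_ppet : pp ≠ pp + et := fun h => by have := congrArg (· 0) h; simp at this
/-- `2t + e ≠ 3t`. -/
theorem ppz2_ne_ppet : pp + z2 ≠ pp + et := fun h => by have := congrArg (· 0) h; simp at this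

/-- Three-letter rows subtract letter-wise. -/
theorem row3_sub (x y z x' y' z' : ℂ) : row3 x y z - row3 x' y' z' = row3 (x - x') (y - y') (z - z') := by
  simp only [row3, map_sub]; ring

/-- tails `u = (2X^a, −2X^a, −4X^e)`: the factors `1 + u_j` satisfy the CARRY RELATION `(1+2X^a)(1−2X^a) = 1 − 4X^e`. -/
def du : Fin 3 → MvPolynomial (Fin 2) ℂ := ![row3 2 0 0, row3 (-2) 0 0, row3 0 (-4) 0]
/-- tails `v = u + τ·X^t`, `τ = (1, 1, −2)` (difference datum of rank one). -/
def dv : Fin 3 → MvPolynomial (Fin 2) ℂ := ![row3 2 0 1, row3 (-2) 0 1, row3 0 (-4) (-2)]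

/-- THE FIRST-VARIATION IDENTITY of the witness: `∏(1+u) − ∏(1+v) = 3X^{(8,8)} + 4X^{(10,10)} + 2X^{(12,12)}` — the `X^t`-strip
`X^t·G_τ` is ABSENT (`G_τ = Σ_j τ_j ∏_{i≠j}(1+u_i) = 0` exactly, by the carry relation), only the `X^{2t}`, `X^{3t}` strips survive. -/
theorem tailDiff_eq :
    tailDiff du dv = monomial pp 3 + monomial (pp + z2) 4 + monomial (pp + et) 2 := by
  have h1 : tailDiff du dv = (1 + row3 2 0 0) * (1 + row3 (-2) 0 0) * (1 + row3 0 (-4) 0)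
      - (1 + row3 2 0 1) * (1 + row3 (-2) 0 1) * (1 + row3 0 (-4) (-2)) := by
    simp [tailDiff, du, dv, Fin.prod_univ_three, mul_assoc]
  have h2 : (1 + row3 2 0 0) * (1 + row3 (-2) 0 0) * (1 + row3 0 (-4) 0)
      - (1 + row3 2 0 1) * (1 + row3 (-2) 0 1) * (1 + row3 0 (-4) (-2))
      = (C 3 * X 0 ^ 8 * X 1 ^ 8 + C 4 * X 0 ^ 10 * X 1 ^ 10 + C 2 * X 0 ^ 12 * X 1 ^ 12 : MvPolynomial (Fin 2) ℂ) := by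
    simp only [row3_eq, map_neg, map_zero, map_one, map_ofNat]
    ring
  have e1 : (Finsupp.single 0 8 + Finsupp.single 1 8 : Expo) = pp := by
    ext i; fin_cases i <;> simp
  have e2 : (Finsupp.single 0 10 + Finsupp.single 1 10 : Expo) = pp + z2 := by
    ext i; fin_cases i <;> simp
  have e3 : (Finsupp.single 0 12 + Finsupp.single 1 12 : Expo) = pp + et := by
    ext i; fin_cases i <;> simp
  rw [h1, h2, C_mul_X_eq, C_mul_X_eq, C_mul_X_eq, e1, e2, e3]

/-- Coefficients of the tail difference of the witness. -/
theorem coeff_tailDiff (q : Expo) :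
    coeff q (tailDiff du dv) = (if pp = q then (3 : ℂ) else 0) + (if pp + z2 = q then (4 : ℂ) else 0)
      + (if pp + et = q then (2 : ℂ) else 0) := by
  rw [tailDiff_eq, coeff_add, coeff_add, coeff_monomial, coeff_monomial, coeff_monomial]

/-- The support of the tail difference is `{2t, 2t+e, 3t} = {(8,8), (10,10), (12,12)}`. -/
theorem mem_support_tailDiff {q : Expo} (hq : q ∈ (tailDiff du dv).support) :
    q = pp ∨ q = pp + z2 ∨ q = pp + et := by
  rw [mem_support_iff, coeff_tailDiff] at hq
  by_contra h
  push Not at h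
  apply hq
  simp [Ne.symm h.1, Ne.symm h.2.1, Ne.symm h.2.2]

/-- `p = (8,8)` carries the coefficient `3 ≠ 0`. -/
theorem pp_mem_support : pp ∈ (tailDiff du dv).support := by
  rw [mem_support_iff, coeff_tailDiff, if_pos rfl, if_neg (Ne.symm pp_ne_ppz2), if_neg (Ne.symm pp_ne_ppet)]
  norm_num

/-- `ξ = (−1,−1)` is a valid weight for the witness. -/
theorem validWeight_xi : ValidWeight du dv xi := by
  refine ⟨fun j q hq => ?_, fun j q hq => ?_⟩ <;> fin_cases j <;> exact wt_row3_neg (by simpa [du, dv] using hq)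

/-- `p = 2t` is the strict `ξ`-top of the tail support (`−16 > −20 > −24`). -/
theorem isStrictTop_pp : IsStrictTop xi (↑(tailDiff du dv).support : Set Expo) pp := by
  refine ⟨by exact_mod_cast pp_mem_support, fun μ hμ hne => ?_⟩
  rcases mem_support_tailDiff (by exact_mod_cast hμ) with rfl | rfl | rfl
  · exact absurd rfl hne
  · rw [wt_xi, wt_xi]; simp; norm_num
  · rw [wt_xi, wt_xi]; simp; norm_num

/-- `p = (8,8)` is LL-visible for the witness; its dyadic class is `(3,3)`. -/
theorem pp_mem_llVisible : pp ∈ llVisible du dv :=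
  ⟨xi, by simp, by simp, validWeight_xi, isStrictTop_pp⟩

/-- Truncated `u`-rows = the `u`-rows (all letters lie inside the 3-digit box `[0,8)²`). -/
theorem boxTrunc_du (j : Fin 3) : boxTrunc 8 8 (du j) = du j := by
  fin_cases j <;> simp [du, boxTrunc_row3]

/-- Truncated `v`-rows = the `v`-rows. -/
theorem boxTrunc_dv (j : Fin 3) : boxTrunc 8 8 (dv j) = dv j := by
  fin_cases j <;> simp [dv, boxTrunc_row3]

/-- No `u`-row involves the letter `t`. -/
theorem coeff_et_du (j : Fin 3) : coeff et (du j) = 0 := by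
  fin_cases j <;> simp [du]

/-- The truncated rows of the two sides are NOT equal as multisets: `v₂ = −4X^e − 2X^t` has a `t`-letter, no `u_j` does
(so they are not equal up to row-wise scalars either). -/
theorem truncated_rows_ne :
    (Finset.univ.val.map fun j => boxTrunc 8 8 (du j)) ≠ (Finset.univ.val.map fun j => boxTrunc 8 8 (dv j)) := by
  intro h
  have hmem : boxTrunc 8 8 (dv 2) ∈ (Finset.univ.val.map fun j => boxTrunc 8 8 (du j)) := by
    rw [h]; exact Multiset.mem_map.2 ⟨2, Finset.mem_univ_val 2, rfl⟩
  obtain ⟨j, -, hj⟩ := Multiset.mem_map.1 hmem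
  rw [boxTrunc_du, boxTrunc_dv] at hj
  have hc := congrArg (coeff et) hj
  rw [coeff_et_du] at hc
  simp [dv] at hc

/-- «The truncated table has AFFINE RANK ≤ 2» in its weakest reading: all `2m` truncated rows lie in ONE affine 2-plane
`w₀ + span{w₁, w₂}` (the projective / linear-rank-2 reading of RIGID-BOX implies this one). -/
def AffRankLeTwo {m : ℕ} (N M : ℕ) (u v : Fin m → MvPolynomial (Fin 2) ℂ) : Prop :=
  ∃ w₀ w₁ w₂ : MvPolynomial (Fin 2) ℂ, ∀ j,
    boxTrunc N M (u j) - w₀ ∈ Submodule.span ℂ ({w₁, w₂} : Set (MvPolynomial (Fin 2) ℂ)) ∧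
    boxTrunc N M (v j) - w₀ ∈ Submodule.span ℂ ({w₁, w₂} : Set (MvPolynomial (Fin 2) ℂ))

/-- the three difference vectors of the witness table: `u₁ − u₀ = −4X^a`, `u₂ − u₀ = −2X^a − 4X^e`, `v₀ − u₀ = X^t`. -/
def dvec : Fin 3 → MvPolynomial (Fin 2) ℂ := ![row3 (-4) 0 0, row3 (-2) (-4) 0, row3 0 0 1]

/-- The three difference vectors are linearly independent (read off the coefficients at `t`, `e`, `a`). -/
theorem linearIndependent_dvec : LinearIndependent ℂ dvec := by
  rw [Fintype.linearIndependent_iff]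
  intro g hg
  have ht := congrArg (coeff et) hg
  have he := congrArg (coeff z2) hg
  have ha := congrArg (coeff zz) hg
  simp only [Fin.sum_univ_three, dvec, Matrix.cons_val_zero, Matrix.cons_val_one, Matrix.cons_val_two,
    Matrix.head_cons, Matrix.tail_cons, coeff_add, coeff_smul, coeff_zero, coeff_row3_zz, coeff_row3_z2, coeff_row3_et,
    smul_eq_mul, mul_zero, add_zero, zero_add, mul_one] at ht he ha
  -- ht : g 2 = 0,  he : g 1 * (-4) = 0,  ha : g 0 * (-4) + g 1 * (-2) = 0
  have g2 : g 2 = 0 := by linear_combination ht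
  have g1 : g 1 = 0 := by linear_combination he / (-4)
  have g0 : g 0 = 0 := by linear_combination ha / (-4) - g1 / 2
  intro i; fin_cases i
  · exact g0
  · exact g1
  · exact g2

/-- The witness table does NOT have affine rank ≤ 2. -/
theorem not_affRankLeTwo : ¬ AffRankLeTwo 8 8 du dv := by
  rintro ⟨w₀, w₁, w₂, h⟩
  set S : Submodule ℂ (MvPolynomial (Fin 2) ℂ) := Submodule.span ℂ ({w₁, w₂} : Set (MvPolynomial (Fin 2) ℂ)) with hS
  -- the three differences lie in `S`
  have hd : ∀ i, dvec i ∈ S := by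
    have h0 := (h 0).1; have h1 := (h 1).1; have h2 := (h 2).1; have h0' := (h 0).2
    rw [boxTrunc_du] at h0 h1 h2; rw [boxTrunc_dv] at h0'
    have d1 : du 1 - du 0 ∈ S := by
      have := S.sub_mem h1 h0; simpa using this
    have d2 : du 2 - du 0 ∈ S := by
      have := S.sub_mem h2 h0; simpa using this
    have d3 : dv 0 - du 0 ∈ S := by
      have := S.sub_mem h0' h0; simpa using this
    have e1 : du 1 - du 0 = dvec 0 := by
      simp only [du, dvec, Matrix.cons_val_zero, Matrix.cons_val_one, row3_sub]; norm_num
    have e2 : du 2 - du 0 = dvec 1 := by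
      simp only [du, dvec, Matrix.cons_val_zero, Matrix.cons_val_one, Matrix.cons_val_two, Matrix.head_cons,
        Matrix.tail_cons, row3_sub]; norm_num
    have e3 : dv 0 - du 0 = dvec 2 := by
      simp only [du, dv, dvec, Matrix.cons_val_zero, Matrix.cons_val_two, Matrix.head_cons, Matrix.tail_cons,
        row3_sub]; norm_num
    intro i; fin_cases i
    · exact e1 ▸ d1
    · exact e2 ▸ d2
    · exact e3 ▸ d3
  -- `S` is spanned by two vectors, so `finrank S ≤ 2`
  have hfin : Module.finrank ℂ S ≤ 2 := by
    have h2 := finrank_span_finset_le_card (R := ℂ) ({w₁, w₂} : Finset (MvPolynomial (Fin 2) ℂ))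
    rw [Finset.coe_pair] at h2
    exact h2.trans Finset.card_le_two
  -- but the three differences are independent inside `S`
  let f : Fin 3 → S := fun i => ⟨dvec i, hd i⟩
  have hf : LinearIndependent ℂ f := by
    apply LinearIndependent.of_comp S.subtype
    exact linearIndependent_dvec
  haveI : Module.Finite ℂ S := Module.Finite.span_of_finite ℂ (Set.toFinite _)
  have h3 : 3 ≤ Module.finrank ℂ S := by
    simpa using hf.fintype_card_le_finrank
  omega

/-- `a = zz ∈ A_3` (digit grid with `s = 3`). -/
theorem zz_mem_digitGrid_three : zz ∈ DigitGrid 3 := ⟨0, 0, by norm_num, by norm_num, by simp, by simp⟩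
/-- `e = z2 ∈ A_3`. -/
theorem z2_mem_digitGrid_three : z2 ∈ DigitGrid 3 := ⟨1, 1, by norm_num, by norm_num, by simp, by simp⟩
/-- `t = et ∈ A_3`. -/
theorem et_mem_digitGrid_three : et ∈ DigitGrid 3 := ⟨2, 2, by norm_num, by norm_num, by simp, by simp⟩

/-- Three-letter rows are supported on the digit grid `A_3`. -/
theorem row3_support_digitGrid_three {x y z : ℂ} : ∀ q ∈ (row3 x y z).support, q ∈ DigitGrid 3 := fun q hq => by
  rcases mem_support_row3 hq with rfl | rfl | rfl
  exacts [zz_mem_digitGrid_three, z2_mem_digitGrid_three, et_mem_digitGrid_three]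

/-- `u` is supported on `A_3`. -/
theorem du_digitGrid : ∀ j, ∀ q ∈ (du j).support, q ∈ DigitGrid 3 := by
  intro j; fin_cases j <;> exact row3_support_digitGrid_three
/-- `v` is supported on `A_3`. -/
theorem dv_digitGrid : ∀ j, ∀ q ∈ (dv j).support, q ∈ DigitGrid 3 := by
  intro j; fin_cases j <;> exact row3_support_digitGrid_three

/-- THE WITNESS (`s = 3`, `m = 3`, base 2): a digit-grid instance with an LL-visible point `p = (2³,2³)` of class `(3,3)` whose
3-digit identity box `[0,2³)²` has truncated rows that NEITHER coincide as multisets NOR lie in an affine 2-plane. -/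
theorem vandermondeDefect_witness :
    (∀ j, ∀ q ∈ (du j).support, q ∈ DigitGrid 3) ∧ (∀ j, ∀ q ∈ (dv j).support, q ∈ DigitGrid 3) ∧
    pp ∈ llVisible du dv ∧ pp 0 = 2 ^ 3 ∧ pp 1 = 2 ^ 3 ∧
    (Finset.univ.val.map fun j => boxTrunc (2 ^ 3) (2 ^ 3) (du j)) ≠
      (Finset.univ.val.map fun j => boxTrunc (2 ^ 3) (2 ^ 3) (dv j)) ∧
    ¬ AffRankLeTwo (2 ^ 3) (2 ^ 3) du dv :=
  ⟨du_digitGrid, dv_digitGrid, pp_mem_llVisible, by simp, by simp,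
    by rw [show (2 : ℕ) ^ 3 = 8 by norm_num]; exact truncated_rows_ne,
    by rw [show (2 : ℕ) ^ 3 = 8 by norm_num]; exact not_affRankLeTwo⟩

/-! ## §2  The rigidity-or-rank-two dichotomy (D2) fails at `m = 3` -/

/-- D2 (val-idea-crit-8 g3, 2026-08-29T02:52:24Z), typed with the quantifier shape of `not_rowCoincidence_on_digitGrid`:
«below every LL-visible point of a digit-grid instance the truncated rows coincide as multisets OR the truncated table has
affine rank ≤ 2».  FALSE: the Vandermonde-defect witness (class `(3,3)`, box `[0,8)²`). -/
theorem not_coincidence_or_affRankLeTwo :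
    ¬ (∀ (m s : ℕ) (u v : Fin m → MvPolynomial (Fin 2) ℂ),
        (∀ j, ∀ e ∈ (u j).support, e ∈ DigitGrid s) → (∀ j, ∀ e ∈ (v j).support, e ∈ DigitGrid s) →
        ∀ p ∈ llVisible u v, ∀ N M : ℕ, N ≤ p 0 + 1 → M ≤ p 1 + 1 → (N ≤ p 0 ∨ M ≤ p 1) →
          (Finset.univ.val.map fun j => boxTrunc N M (u j)) = (Finset.univ.val.map fun j => boxTrunc N M (v j)) ∨
          AffRankLeTwo N M u v) := by
  intro h
  rcases h 3 3 du dv du_digitGrid dv_digitGrid pp pp_mem_llVisible 8 8 (by simp) (by simp) (Or.inl (by simp)) with h | h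
  · exact truncated_rows_ne h
  · exact not_affRankLeTwo h

end Summit.ValiantsHypothesis.ValiantsHypothesis.Theorems.NewtonUnitEquations.TwoProducts.Negative.VandermondeDefect

end
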